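import Summits.BirchSwinnertonDyer.BirchSwinnertonDyer.Theorems.ByReductionTypeAtTwoMultOddBranchFunctionalEquation
import Literature.NumberTheory.EllipticCurves.PAdicLFunctionMinusMultTwistFunctionalEquationProofs
import HarnessLib

/-!
# Route ByReductionTypeAtTwo, crux `AdditivePotMultOverKAtTwo` (stmt-BirchSwinnertonDyer-22618; parent
# `AdditiveRankZeroAtTwo` 19098) — the (−2)-block twin of T20 (d) IN THE KERNEL, part 1: the functional
# equation of the `χ₂`-TWISTED odd branches `L⁻_2(f, ±1, ω^i χ₂, T)` of a curve with MULTIPLICATIVE reduction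
# at `2`, in `ℚ₂⟦T⟧` and in `Λ` (`(ι b) = (b)` for every integral multiple `b`), split and non-split

Cell `bsd-2adic`, seat `bsd-2adic-t42` GEN 21 (AP3′, sequel of AP3-R2 = `ByReductionTypeAtTwoMultOddBranchFunctionalEquation`).
HONEST FRAMING (D-0036 / D-0054): theorems only — no definition, no named fact, no instance, no `sorry`;
route-independent (no `Theses` import); types-the-object-of; closes none; nothing booked; BSD is not proved by any
of this. PARTITION: X5@2 additive, the `(−2)`-split-twist block of C4″ 22618 × p = 2 (`E = E'' ⊗ χ_{−2}`,
`E''` split multiplicative at `2`, `χ_{−2} = ω χ₂`: the cyclotomic Iwasawa theory of `E` over `ℚ_∞` sits in the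
branch `ω·χ₂` of `E''`, tree `padicLFunctionMinusBranchMultTwist f 1 1 (−1)`, addL2x GEN 16).

The Literature file `PAdicLFunctionMinusMultTwistFunctionalEquationProofs` (this seat) proves Mazur–Tate–Teitelbaum
§I.17 for the `ω^i ψ`-branches of the one-term measure at `p ∥ N` for every QUADRATIC `ψ` (`ψ(γ) = ε`,
`ε^{p^j} = 1`, `ε² = 1`). At `p = 2`, `j = 1`, `ε = −1` (`ψ = χ₂`, the character of `ℚ(√2) ⊂ ℚ_∞`):

* §1 `exists_subst_padicLFunctionMinusBranchMultTwist_two_eq_of_split` / `…_of_nonsplit` — for an elliptic `V/ℚ`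
  split (resp. non-split) multiplicative at `2` and its newform `f` (ANY level), every `i`:
  `∃ w = ±1, c ∈ ℤ₂`, `L⁻_2(f, ±1, ω^i χ₂, ι(T)) = w (1+T)^c L⁻_2(f, ±1, ω^i χ₂, T)`.
* §2 Λ-descent `IwasawaAlgebra.span_singleton_subst_eq_of_eq_oddBranchMultTwist_two_of_split` / `…_of_nonsplit`
  and **`map_invol_span_eq_of_eq_oddBranchMultTwist_two_of_split`** / `…_of_nonsplit`:
  `(Ideal.span {b}).map (IwasawaAlgebra.invol 2).toRingHom = Ideal.span {b}` for EVERY integral multiple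
  `b^ℚ = C t · L⁻_2(f, ±1, ω^i χ₂, T)` — the binder `hLtι` of the addL2x (−2)-block doors
  (`…AdditiveKatoTransportNegTwoPrintExact`) from `hsp + hf + hLt` alone. The re-glued doors are the sequel
  `ByReductionTypeAtTwoAdditiveOddBranchTwistFEDoor.lean`.

References: [MazurTateTeitelbaum1986Invent] §I.13, §I.17; [GreenbergLNM1716] §1 pp. 67–68; [Knapp1993] Thm. 9.27(b);
[BurungaleSkinner2023] Prop. 2.2; memo `run/shared/lean/pub/bsd-2adic/t42/DESIGN-T42-ADDENDUM-25.md`.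
-/

set_option autoImplicit false
-- the summit's namespace `Summit.BirchSwinnertonDyer.BirchSwinnertonDyer` (Sub = Summit) trips `dupNamespace`
set_option linter.dupNamespace false

noncomputable section

open scoped Classical MatrixGroups ModularForm NumberField

open Field CongruenceSubgroup PowerSeries WeierstrassCurve IsDedekindDomain
  Literature.NumberTheory.EllipticCurves Literature.NumberTheory.EllipticCurves.ModularForms
  Literature.NumberTheory.EllipticCurves.Module Literature.Barriers.BirchSwinnertonDyer
  Summit.BirchSwinnertonDyer.BirchSwinnertonDyer.Theorems.SignedKatoOffTwo

namespace Summit.BirchSwinnertonDyer.BirchSwinnertonDyer.Theorems.MultOddBranchFE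

/-! ## §1 The functional equation of the `χ₂`-twisted odd branches at a multiplicative `2` -/

section FE

variable {V : WeierstrassCurve ℚ} {N : ℕ} [NeZero N] {f : CuspForm (Gamma0 N) 2}

/-- **FE of the `χ₂`-twisted odd branches at a SPLIT multiplicative `2`** (Mazur–Tate–Teitelbaum 1986, §I.17,
via `exists_subst_padicLFunctionMinusBranchMultTwist_eq` at `ε = −1`, `j = 1`): for an elliptic `V/ℚ` split
multiplicative at `2`, its newform `f ∈ S₂(Γ₀(N))` (any level) and every `i`, there are `w = ±1 ∈ ℤ` and
`c ∈ ℤ₂` with `L⁻_2(f, 1, ω^i χ₂, ι(T)) = w · (1+T)^c · L⁻_2(f, 1, ω^i χ₂, T)` for every `ι` with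
`(1+T)(1+ι) = 1` (`w = −λ_M(f)·χ₋₄(−M)^i·χ₂(⟨M⟩)`, `N = 2M`, `⟨M⟩ = 5^c`).
[cite: MazurTateTeitelbaum1986Invent, §I.17] [cite: Knapp1993, Thm. 9.27(b)] -/
theorem exists_subst_padicLFunctionMinusBranchMultTwist_two_eq_of_split
    (hsp : V.HasSplitMultiplicativeReductionAtPrime 2) (hf : IsNewformOf V f) (i : ℕ) :
    ∃ w : ℤ, w ^ 2 = 1 ∧ ∃ c : ℤ_[2], ∀ {ι : ℚ_[2]⟦X⟧}, (1 + X : ℚ_[2]⟦X⟧) * (ι + 1) = 1 →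
      PowerSeries.subst ι (padicLFunctionMinusBranchMultTwist f (1 : ℚ_[2]) i (-1)) =
        C ((w : ℤ) : ℚ_[2]) * PowerSeries.binomialSeries ℚ_[2] c *
          padicLFunctionMinusBranchMultTwist f (1 : ℚ_[2]) i (-1) := by
  obtain ⟨hNM, hM⟩ := level_eq_two_mul_of_dvd_of_not_four_dvd (hf.dvd_level_of_split hsp)
    (not_four_dvd_level_of_split hsp hf)
  have hap : cuspCoeff f 2 = ((1 : ℤ) : ℂ) := by
    rw [Int.cast_one]; exact (hf.cuspCoeff_eq_one_and_sq_of_split hsp).1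
  have hε : (-1 : ℚ_[2]) ^ 2 ^ 1 = 1 := by norm_num
  have hε2 : (-1 : ℚ_[2]) ^ 2 = 1 := by norm_num
  have h := exists_subst_padicLFunctionMinusBranchMultTwist_eq (p := 2) hf.1 hf.coeffField_eq_bot hNM hM hap
    (by norm_num) (torsionOrder_two_dvd i) hε hε2
  simpa only [Int.cast_one] using h

/-- **FE of the `χ₂`-twisted odd branches at a NON-SPLIT multiplicative `2`** (`a₂(f) = −1`):
`∃ w = ±1, c ∈ ℤ₂`, `L⁻_2(f, −1, ω^i χ₂, ι(T)) = w · (1+T)^c · L⁻_2(f, −1, ω^i χ₂, T)`.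
[cite: MazurTateTeitelbaum1986Invent, §I.17] [cite: Knapp1993, Thm. 9.27(b)] -/
theorem exists_subst_padicLFunctionMinusBranchMultTwist_two_eq_of_nonsplit
    (hmult : V.HasMultiplicativeReductionAtPrime 2) (hns : ¬ V.HasSplitMultiplicativeReductionAtPrime 2)
    (hf : IsNewformOf V f) (i : ℕ) :
    ∃ w : ℤ, w ^ 2 = 1 ∧ ∃ c : ℤ_[2], ∀ {ι : ℚ_[2]⟦X⟧}, (1 + X : ℚ_[2]⟦X⟧) * (ι + 1) = 1 →
      PowerSeries.subst ι (padicLFunctionMinusBranchMultTwist f (-1 : ℚ_[2]) i (-1)) =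
        C ((w : ℤ) : ℚ_[2]) * PowerSeries.binomialSeries ℚ_[2] c *
          padicLFunctionMinusBranchMultTwist f (-1 : ℚ_[2]) i (-1) := by
  obtain ⟨ha, h2⟩ := hf.cuspCoeff_eq_neg_one_and_dvd_of_nonsplit hmult hns
  obtain ⟨hNM, hM⟩ := level_eq_two_mul_of_dvd_of_not_four_dvd h2
    (not_four_dvd_level_of_nonsplit hf hmult hns)
  have hap : cuspCoeff f 2 = ((-1 : ℤ) : ℂ) := by rw [Int.cast_neg, Int.cast_one]; exact ha
  have hε : (-1 : ℚ_[2]) ^ 2 ^ 1 = 1 := by norm_num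
  have hε2 : (-1 : ℚ_[2]) ^ 2 = 1 := by norm_num
  have h := exists_subst_padicLFunctionMinusBranchMultTwist_eq (p := 2) hf.1 hf.coeffField_eq_bot hNM hM hap
    (by norm_num) (torsionOrder_two_dvd i) hε hε2
  simpa only [Int.cast_neg, Int.cast_one] using h

end FE

/-! ## §2 Ideal forms in `Λ = ℤ₂⟦T⟧` for integral multiples -/

section Ideal

variable {V : WeierstrassCurve ℚ} {N : ℕ} [NeZero N] {f : CuspForm (Gamma0 N) 2}

/-- **`(b(T^ι)) = (b)` in `Λ = ℤ₂⟦T⟧` for every integral multiple `b` of a `χ₂`-twisted odd branch at a SPLIT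
multiplicative `2`** (`b^ℚ = C t · L⁻_2(f, 1, ω^i χ₂, T)`; Burungale–Skinner descent
`IwasawaAlgebra.span_singleton_subst_eq_of_iwasawaToPowerSeries_eq`). [cite: MazurTateTeitelbaum1986Invent, §I.17]
[cite: BurungaleSkinner2023, Prop. 2.2 (proof)] [cite: GreenbergLNM1716, §1 (p. 68)] -/
theorem _root_.Literature.NumberTheory.EllipticCurves.IwasawaAlgebra.span_singleton_subst_eq_of_eq_oddBranchMultTwist_two_of_split
    (hsp : V.HasSplitMultiplicativeReductionAtPrime 2) (hf : IsNewformOf V f) {i : ℕ}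
    {b : IwasawaAlgebra 2} {t : ℚ_[2]}
    (hb : iwasawaToPowerSeries 2 b = C t * padicLFunctionMinusBranchMultTwist f (1 : ℚ_[2]) i (-1)) :
    Ideal.span {b.subst (invOnePlusSubOne : ℤ_[2]⟦X⟧)} = Ideal.span {b} := by
  obtain ⟨w, hw, c, hFE⟩ := exists_subst_padicLFunctionMinusBranchMultTwist_two_eq_of_split hsp hf i
  exact IwasawaAlgebra.span_singleton_subst_eq_of_iwasawaToPowerSeries_eq hw
    (hFE one_add_X_mul_invOnePlusSubOne_add_one) hb

/-- **`(b(T^ι)) = (b)` in `Λ` for every integral multiple `b` of a `χ₂`-twisted odd branch at a NON-SPLIT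
multiplicative `2`** (`b^ℚ = C t · L⁻_2(f, −1, ω^i χ₂, T)`). [cite: MazurTateTeitelbaum1986Invent, §I.17]
[cite: BurungaleSkinner2023, Prop. 2.2 (proof)] -/
theorem _root_.Literature.NumberTheory.EllipticCurves.IwasawaAlgebra.span_singleton_subst_eq_of_eq_oddBranchMultTwist_two_of_nonsplit
    (hmult : V.HasMultiplicativeReductionAtPrime 2) (hns : ¬ V.HasSplitMultiplicativeReductionAtPrime 2)
    (hf : IsNewformOf V f) {i : ℕ} {b : IwasawaAlgebra 2} {t : ℚ_[2]}
    (hb : iwasawaToPowerSeries 2 b = C t * padicLFunctionMinusBranchMultTwist f (-1 : ℚ_[2]) i (-1)) :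
    Ideal.span {b.subst (invOnePlusSubOne : ℤ_[2]⟦X⟧)} = Ideal.span {b} := by
  obtain ⟨w, hw, c, hFE⟩ :=
    exists_subst_padicLFunctionMinusBranchMultTwist_two_eq_of_nonsplit hmult hns hf i
  exact IwasawaAlgebra.span_singleton_subst_eq_of_iwasawaToPowerSeries_eq hw
    (hFE one_add_X_mul_invOnePlusSubOne_add_one) hb

/-- Through the NAMED involution and `Ideal.map` (the spelling of the addL2x doors): **`ι((b)) = (b)`** for every
integral multiple `b` of a `χ₂`-twisted odd branch at a split multiplicative `2` — the binder `hLtι` of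
`AddKatoTwo.lengthAt_selmerDualContra_le_of_oddBranchInputsNegTwoPrintExact` from `hsp + hf + hLt` alone.
[cite: MazurTateTeitelbaum1986Invent, §I.17] [cite: GreenbergLNM1716, §1 (p. 68)] -/
theorem map_invol_span_eq_of_eq_oddBranchMultTwist_two_of_split
    (hsp : V.HasSplitMultiplicativeReductionAtPrime 2) (hf : IsNewformOf V f) {i : ℕ}
    {b : IwasawaAlgebra 2} {t : ℚ_[2]}
    (hb : iwasawaToPowerSeries 2 b = C t * padicLFunctionMinusBranchMultTwist f (1 : ℚ_[2]) i (-1)) :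
    (Ideal.span {b}).map (IwasawaAlgebra.invol 2).toRingHom = Ideal.span {b} := by
  rw [Ideal.map_span, Set.image_singleton]
  change Ideal.span {IwasawaAlgebra.invol 2 b} = Ideal.span {b}
  rw [Invol.invol_eq_subst_invOnePlusSubOne]
  exact IwasawaAlgebra.span_singleton_subst_eq_of_eq_oddBranchMultTwist_two_of_split hsp hf hb

/-- Non-split twin: **`ι((b)) = (b)`** for every integral multiple `b` of `L⁻_2(f, −1, ω^i χ₂, T)` at a non-split
multiplicative `2`. [cite: MazurTateTeitelbaum1986Invent, §I.17] -/
theorem map_invol_span_eq_of_eq_oddBranchMultTwist_two_of_nonsplit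
    (hmult : V.HasMultiplicativeReductionAtPrime 2) (hns : ¬ V.HasSplitMultiplicativeReductionAtPrime 2)
    (hf : IsNewformOf V f) {i : ℕ} {b : IwasawaAlgebra 2} {t : ℚ_[2]}
    (hb : iwasawaToPowerSeries 2 b = C t * padicLFunctionMinusBranchMultTwist f (-1 : ℚ_[2]) i (-1)) :
    (Ideal.span {b}).map (IwasawaAlgebra.invol 2).toRingHom = Ideal.span {b} := by
  rw [Ideal.map_span, Set.image_singleton]
  change Ideal.span {IwasawaAlgebra.invol 2 b} = Ideal.span {b}
  rw [Invol.invol_eq_subst_invOnePlusSubOne]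
  exact IwasawaAlgebra.span_singleton_subst_eq_of_eq_oddBranchMultTwist_two_of_nonsplit hmult hns hf hb

end Ideal

end Summit.BirchSwinnertonDyer.BirchSwinnertonDyer.Theorems.MultOddBranchFE

end
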